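import Summits.CriticalPhenomena.SAWScalingLimit.Theorems.SAWLoopFugacityFlowIsingBoundaryRatioAnchorWalk
import Summits.CriticalPhenomena.SAWScalingLimit.Theorems.SAWLoopFugacityFlowIsingBoundaryRatioChartAnnulusSeparation
import HarnessLib

/-!
# The common window of two locally agreeing finite volumes (line `fk-anchor-transfer`, ASM geometry)
(crux `SAWLoopFugacityFlow.IsingBoundaryRatio`, stmt-CriticalPhenomena-10650)

Two finite-volume graphs `(G₁, Λ₁)`, `(G₂, Λ₂)` agreeing locally with the mesh graph `Ω_δ` in the ball
`B(a, ε)` and containing a common anchor `x` share the WINDOW `Wt` of sites joined to `x` by walks of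
`Ω_δ` whose vertices have mesh points in `B(a, ε)`: `Wt ⊆ Λ₁ ∩ Λ₂` (local agreement closes a volume
under the mesh neighbours of its sites in the ball), the two graphs `Gᵢ.comap val` induce the same
adjacency on `Wt`, every `Gᵢ`-neighbour of a window site with mesh point in `B(a, 3ε/4)` is a window
site (the core `W₀`), and — by the one-component property of small chart discs
(`ChartDiscOneComponent`) — every vertex of `Ω_δ` of small chart radius belongs to `Λ₁ ∩ Λ₂`, and if
its mesh point lies in `B(a, ε/2)` it belongs to the core. This is the vertex window across which the
conditional inside probabilities of Kesten's scheme are transported between the two graphs.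
Folklore bookkeeping; no new definitions (the window is produced existentially).
-/

noncomputable section

open scoped Classical Topology
open Filter Set Metric SimpleGraph
open Literature.Probability.LatticeModels Literature.Probability.RandomPlanarGeometry
open UpperHalfPlane (upperHalfPlaneSet)

namespace Summit.CriticalPhenomena.SAWScalingLimit.Theorems.IsingBoundaryRatio

/-- **A locally agreeing volume is closed under ball walks**: if `(G, Λ)` agrees locally with `Ω_δ` in
`B(p, ε)`, every walk of `Ω_δ` from a site of `Λ` all of whose vertices have mesh point in the ball stays
in `Λ`. [folklore] -/
theorem forall_mem_support_mem_of_localAgreement {Ω : Set ℂ} {p : ℂ} {ε δ : ℝ} {G : SimpleGraph (Site 2)}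
    {Λ : Finset (Site 2)} (hLA : LocalAgreement Ω p ε δ G Λ) :
    ∀ {a b : Site 2} (w : (discreteDomainGraph Ω δ).Walk a b), a ∈ Λ →
      (∀ z ∈ w.support, meshPoint δ z ∈ Metric.ball p ε) → ∀ z ∈ w.support, z ∈ Λ
  | _, _, Walk.nil, ha, _, z, hz => by
    rw [Walk.support_nil, List.mem_singleton] at hz
    rw [hz]; exact ha
  | a, _, Walk.cons (v := c) h q, ha, hball, z, hz => by
    have hpa : meshPoint δ a ∈ Metric.ball p ε := hball a (Walk.start_mem_support _)
    have hc : c ∈ Λ := (hLA a ha hpa c).2 h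
    rw [Walk.support_cons, List.mem_cons] at hz
    rcases hz with rfl | hz
    · exact ha
    · exact forall_mem_support_mem_of_localAgreement hLA q hc
        (fun z hz => hball z (by rw [Walk.support_cons]; exact List.mem_cons_of_mem _ hz)) z hz

/-- **The common window** (see the module docstring). For the chordal chart `φ` of `(D; a, b)` with the
one-component property of small chart discs, and `ε > 0`: there is `R₀ > 0` such that for every window
radius `Rw ∈ (0, R₀)` there is `r > 0` with, for all small `δ`: for any two finite volumes `(G₁, Λ₁)`,
`(G₂, Λ₂)` agreeing locally with `Ω_δ` in `B(a, ε)` and a common site `x ∈ Λ₁ ∩ Λ₂` of `Ω_δ` within `r`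
of `a`, some `Wt ⊆ Λ₁ ∩ Λ₂` containing `x` carries the same adjacency from `G₁.comap val` and
`G₂.comap val`; every neighbour (in either graph) of a site of `Wt` with mesh point in `B(a, 3ε/4)` lies
in `Wt`; every site of `Λᵢ` that is a vertex of `Ω_δ` with mesh point in `B(a, ε/2)` and chart radius
`< Rw` is such a core site of `Wt`; and every vertex of `Ω_δ` of chart radius `< Rw` lies in `Λ₁ ∩ Λ₂`.
[folklore] -/
theorem exists_common_window :
    ∀ (D : DobrushinDomain) (φ : ConformalEquiv upperHalfPlaneSet D.carrier), D.IsChordalUniformizing φ →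
      ChartDiscOneComponent →
    ∀ (ε : ℝ), 0 < ε → ∃ R₀ : ℝ, 0 < R₀ ∧ ∀ (Rw : ℝ), 0 < Rw → Rw < R₀ → ∃ r : ℝ, 0 < r ∧
      ∀ᶠ δ in 𝓝[>] (0 : ℝ),
      ∀ (G₁ : SimpleGraph (Site 2)) [G₁.LocallyFinite] (G₂ : SimpleGraph (Site 2)) [G₂.LocallyFinite]
        (Λ₁ Λ₂ : Finset (Site 2)) (x : Site 2),
        LocalAgreement D.carrier (D.pt 0) ε δ G₁ Λ₁ → LocalAgreement D.carrier (D.pt 0) ε δ G₂ Λ₂ →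
        x ∈ Λ₁ → x ∈ Λ₂ → x ∈ meshDomain D.carrier δ → dist (meshPoint δ x) (D.pt 0) < r →
        ∃ Wt : Finset (Site 2), Wt ⊆ Λ₁ ∧ Wt ⊆ Λ₂ ∧ x ∈ Wt ∧
          (∀ a ∈ Wt, ∀ b ∈ Wt, G₁.Adj a b ↔ G₂.Adj a b) ∧
          (∀ a ∈ Wt, meshPoint δ a ∈ Metric.ball (D.pt 0) (3 * ε / 4) →
            ∀ v : Site 2, (G₁.Adj a v ∨ G₂.Adj a v) → v ∈ Wt) ∧
          (∀ v : Site 2, (v ∈ Λ₁ ∨ v ∈ Λ₂) → v ∈ meshDomain D.carrier δ →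
            meshPoint δ v ∈ Metric.ball (D.pt 0) (ε / 2) → ‖φ.symm (meshPoint δ v)‖ < Rw →
              v ∈ Wt ∧ meshPoint δ v ∈ Metric.ball (D.pt 0) (3 * ε / 4)) ∧
          (∀ v ∈ meshDomain D.carrier δ, ‖φ.symm (meshPoint δ v)‖ < Rw → v ∈ Λ₁ ∧ v ∈ Λ₂) ∧
          (∀ a ∈ Wt, meshPoint δ a ∈ Metric.ball (D.pt 0) ε ∧ a ∈ meshDomain D.carrier δ) := by
  intro D φ hφ h1 ε hε
  -- points of `D` close to `a` have small chart radius
  have hsmall : ∀ t : ℝ, 0 < t → ∃ r : ℝ, 0 < r ∧ ∀ z ∈ D.carrier, dist z (D.pt 0) < r →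
      ‖φ.symm z‖ < t := by
    intro t ht
    obtain ⟨r, hr, h⟩ := Metric.tendsto_nhdsWithin_nhds.1 hφ.tendsto_symm_nhds_zero t ht
    exact ⟨r, hr, fun z hz hzr => by simpa [dist_zero_right] using h hz hzr⟩
  -- `R₀` from the one-component property at radius `ε/2`
  obtain ⟨R₀, hR₀, hR₀'⟩ := h1 D φ hφ (ε / 2) (half_pos hε)
  refine ⟨R₀, hR₀, fun Rw hRw hRwR₀ => ?_⟩
  have hE := hR₀' Rw hRw hRwR₀
  obtain ⟨r, hr, hr'⟩ := hsmall Rw hRw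
  refine ⟨min r (ε / 2), lt_min hr (half_pos hε), ?_⟩
  filter_upwards [hE, Ioo_mem_nhdsGT (show (0 : ℝ) < ε / 4 by positivity)] with δ hδ hδε G₁ _ G₂ _
    Λ₁ Λ₂ x hLA₁ hLA₂ hx₁ hx₂ hxm hdx
  -- the window: sites of `Λ₁` joined to `x` by an `Ω_δ`-walk inside the ball
  set reach : Site 2 → Prop := fun v => ∃ w : (discreteDomainGraph D.carrier δ).Walk x v,
    ∀ z ∈ w.support, meshPoint δ z ∈ Metric.ball (D.pt 0) ε with hreach
  have hxball : meshPoint δ x ∈ Metric.ball (D.pt 0) ε := by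
    rw [Metric.mem_ball]; exact (hdx.trans_le (min_le_right _ _)).trans (half_lt_self hε)
  have hreach_x : reach x := ⟨Walk.nil, fun z hz => by
    rw [Walk.support_nil, List.mem_singleton] at hz; rw [hz]; exact hxball⟩
  -- reachable sites lie in both volumes, are mesh sites, and have mesh point in the ball
  have hreach_mem : ∀ v, reach v → v ∈ Λ₁ ∧ v ∈ Λ₂ ∧ v ∈ meshDomain D.carrier δ ∧
      meshPoint δ v ∈ Metric.ball (D.pt 0) ε := by
    rintro v ⟨w, hw⟩
    exact ⟨forall_mem_support_mem_of_localAgreement hLA₁ w hx₁ hw v w.end_mem_support,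
      forall_mem_support_mem_of_localAgreement hLA₂ w hx₂ hw v w.end_mem_support,
      forall_mem_support_mem_meshDomain w hxm v w.end_mem_support, hw v w.end_mem_support⟩
  -- extension of reachability along a mesh edge staying in the ball
  have hreach_step : ∀ v c, reach v → (discreteDomainGraph D.carrier δ).Adj v c →
      meshPoint δ c ∈ Metric.ball (D.pt 0) ε → reach c := by
    rintro v c ⟨w, hw⟩ hvc hc
    refine ⟨w.append (Walk.cons hvc Walk.nil), fun z hz => ?_⟩
    rw [Walk.support_append, List.mem_append] at hz
    rcases hz with hz | hz
    · exact hw z hz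
    · simp only [Walk.support_cons, Walk.support_nil, List.tail_cons, List.mem_singleton] at hz
      rw [hz]; exact hc
  set Wt : Finset (Site 2) := Λ₁.filter reach with hWt
  have hmemWt : ∀ v, v ∈ Wt ↔ v ∈ Λ₁ ∧ reach v := fun v => by rw [hWt, Finset.mem_filter]
  have hWt_reach : ∀ v, reach v → v ∈ Wt := fun v hv => (hmemWt v).2 ⟨(hreach_mem v hv).1, hv⟩
  refine ⟨Wt, fun v hv => ((hmemWt v).1 hv).1, fun v hv => (hreach_mem v ((hmemWt v).1 hv).2).2.1,
    hWt_reach x hreach_x, ?_, ?_, ?_, ?_, ?_⟩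
  · -- same adjacency on the window
    intro a ha b _
    obtain ⟨ha₁, ha₂, -, hab⟩ := hreach_mem a ((hmemWt a).1 ha).2
    rw [(hLA₁ a ha₁ hab b).1, (hLA₂ a ha₂ hab b).1]
  · -- neighbours of core sites are window sites
    intro a ha hcore v hv
    obtain ⟨ha₁, ha₂, -, hab⟩ := hreach_mem a ((hmemWt a).1 ha).2
    have hmesh : (discreteDomainGraph D.carrier δ).Adj a v := by
      rcases hv with hv | hv
      · exact (hLA₁ a ha₁ hab v).1.1 hv
      · exact (hLA₂ a ha₂ hab v).1.1 hv
    obtain ⟨-, -, hd⟩ := meshPoint_mem_of_discreteDomainGraph_adj hmesh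
    refine hWt_reach v (hreach_step a v ((hmemWt a).1 ha).2 hmesh ?_)
    rw [Metric.mem_ball]
    rw [Metric.mem_ball] at hcore
    calc dist (meshPoint δ v) (D.pt 0) ≤ dist (meshPoint δ v) (meshPoint δ a) + dist (meshPoint δ a) (D.pt 0) :=
          _root_.dist_triangle _ _ _
      _ < ε / 4 + 3 * ε / 4 := by
          refine add_lt_add ?_ hcore
          rw [_root_.dist_comm]
          exact hd.trans_lt (by rw [abs_of_pos hδε.1]; exact hδε.2)
      _ = ε := by ring
  · -- sites of small chart radius with mesh point in `B(a, ε/2)` are core window sites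
    intro v _ hvm hvball hvR
    have hxD : meshPoint δ x ∈ D.carrier := meshDomain_subset_meshVertices _ _ hxm
    have hxR : ‖φ.symm (meshPoint δ x)‖ < Rw := hr' _ hxD (hdx.trans_le (min_le_left _ _))
    obtain ⟨w₀, hw₀⟩ := hδ x hxm v hvm hxR hvR
    have hreachv : reach v :=
      ⟨w₀, fun z hz => Metric.ball_subset_ball (by linarith) (hw₀ z hz)⟩
    refine ⟨hWt_reach v hreachv, Metric.ball_subset_ball (by linarith) hvball⟩
  · -- vertices of `Ω_δ` of small chart radius lie in both volumes
    intro v hvm hvR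
    have hxD : meshPoint δ x ∈ D.carrier := meshDomain_subset_meshVertices _ _ hxm
    have hxR : ‖φ.symm (meshPoint δ x)‖ < Rw := hr' _ hxD (hdx.trans_le (min_le_left _ _))
    obtain ⟨w₀, hw₀⟩ := hδ x hxm v hvm hxR hvR
    have hreachv : reach v :=
      ⟨w₀, fun z hz => Metric.ball_subset_ball (by linarith) (hw₀ z hz)⟩
    exact ⟨(hreach_mem v hreachv).1, (hreach_mem v hreachv).2.1⟩
  · intro a ha
    obtain ⟨-, -, ham, hab⟩ := hreach_mem a ((hmemWt a).1 ha).2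
    exact ⟨hab, ham⟩

end Summit.CriticalPhenomena.SAWScalingLimit.Theorems.IsingBoundaryRatio

end
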